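import Mathlib
import Summits.Ventures.HodgeRepro.Tier4.Common.AdelicDefs

/-!
# Tier4/Line1/RowBasis — LINE L1: the rational ROW basis `(w, wΩ, w₁, w₁Ω)` of the plane, its adelic base change,
and the trace form `β(u, v) = u B vᵀ` (support for (iii′) `exists_rational_conj`, the core of J2.b)

Blind re-derivation cell `pub-hodge-repro`, Tier 4 «prove the step» (README §9–§10), seat t4-L1-p2 (prover, gen 0),
LINE L1.  The ROW convention of typer-2's `unitaryGroup W = {g | g Ω = Ω g ∧ g B gᵀ = B}` (PlaneDefs v0.2,
`IsGenuineRow`): `E′` acts on row vectors by `v ↦ v ᵥ* Ω`, the lines are the row images `{v ᵥ* P}`, the form is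
`β(u, v) = u ᵥ* B ⬝ᵥ v`.  Part A (any field `k`): `α v + β (vΩ) = 0 ⇒ α = β = 0` for rational `α, β` (`Ω² = −d`,
`−d` not a square); the rows `w, wΩ, w₁, w₁Ω` (`w P₀ = w`, `w₁ P₀ = 0`, both non-zero) are independent — non-zero
determinant; `β(uΩ, v) = −β(u, vΩ)` and `β(uΩ, uΩ) = d β(u, u)` from `Ω B = −B Ωᵀ`; definiteness makes `β(w, w) ≠ 0`.
Part B (over the adele ring): rational matrices act on rational row vectors through `algebraMap`; coordinates with
respect to the rational row basis exist and are unique; the adelic form is bilinear and rational on rational vectors.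

Nothing here says anything about the status of the Hodge conjecture for CM abelian varieties, which is NOT proved
(HC_CM is NOT proved by anyone in this repository).
-/

set_option autoImplicit false

noncomputable section

namespace Summit.Ventures.HodgeRepro.Tier4.Line1

open Matrix NumberField Summit.Ventures.HodgeRepro.Tier4.Common

/-! ## Part A — rational row linear algebra in the plane (over any field `k`) -/

section RowRational

variable {k : Type} [Field k] (W : PlaneData k)

/-- `v Ω Ω = −d v` -/
theorem vecMul_vecMul_Omega {d : k} (hΩ : W.Ω * W.Ω = -(d • (1 : Matrix (Fin 4) (Fin 4) k)))
    (v : Fin 4 → k) : (v ᵥ* W.Ω) ᵥ* W.Ω = -(d • v) := by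
  rw [Matrix.vecMul_vecMul, hΩ, Matrix.vecMul_neg, Matrix.vecMul_smul, Matrix.vecMul_one]

/-- for a non-zero rational row vector `v` and RATIONAL `α, β`: `α v + β (v Ω) = 0` forces `α = β = 0` -/
theorem row_eq_zero_of_smul_add_smul {d : k} (hΩ : W.Ω * W.Ω = -(d • (1 : Matrix (Fin 4) (Fin 4) k)))
    (hd : ¬ IsSquare (-d)) {v : Fin 4 → k} (hv : v ≠ 0) {α β : k}
    (h : α • v + β • (v ᵥ* W.Ω) = 0) : α = 0 ∧ β = 0 := by
  have h2 : α • (v ᵥ* W.Ω) - (d * β) • v = 0 := by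
    have := congrArg (fun x => x ᵥ* W.Ω) h
    simp only [Matrix.add_vecMul, Matrix.smul_vecMul, Matrix.zero_vecMul] at this
    rw [vecMul_vecMul_Omega W hΩ] at this
    rw [← this]
    module
  have h3 : (α ^ 2 + d * β ^ 2) • v = 0 := by
    have e : (α ^ 2 + d * β ^ 2) • v =
        α • (α • v + β • (v ᵥ* W.Ω)) - β • (α • (v ᵥ* W.Ω) - (d * β) • v) := by
      module
    rw [e, h, h2, smul_zero, smul_zero, sub_zero]
  have h4 : α ^ 2 + d * β ^ 2 = 0 := (smul_eq_zero.1 h3).resolve_right hv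
  by_cases hβ : β = 0
  · subst hβ
    simp only [ne_eq, OfNat.ofNat_ne_zero, not_false_eq_true, zero_pow, mul_zero, add_zero] at h4
    exact ⟨pow_eq_zero_iff (by norm_num) |>.1 h4, rfl⟩
  · exfalso
    apply hd
    refine ⟨α / β, ?_⟩
    rw [div_mul_div_comm, eq_div_iff (mul_ne_zero hβ hβ)]
    linear_combination (-1 : k) * h4

/-- vanishing coordinates: the rows `w, wΩ, w₁, w₁Ω` (`w P₀ = w`, `w₁ P₀ = 0`, both non-zero) are independent -/
theorem row_coords_eq_zero {d : k} (hΩ : W.Ω * W.Ω = -(d • (1 : Matrix (Fin 4) (Fin 4) k)))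
    (hd : ¬ IsSquare (-d)) {w w₁ : Fin 4 → k} (h0 : w ≠ 0) (h1 : w₁ ≠ 0)
    (hP0 : w ᵥ* W.P 0 = w) (hP1 : w₁ ᵥ* W.P 0 = 0) (c : Fin 4 → k)
    (hc : c 0 • w + c 1 • (w ᵥ* W.Ω) + c 2 • w₁ + c 3 • (w₁ ᵥ* W.Ω) = 0) : c = 0 := by
  have hPΩ : ∀ x : Fin 4 → k, (x ᵥ* W.Ω) ᵥ* W.P 0 = (x ᵥ* W.P 0) ᵥ* W.Ω := by
    intro x
    rw [Matrix.vecMul_vecMul, Matrix.vecMul_vecMul, W.P_comm 0]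
  have hA : c 0 • w + c 1 • (w ᵥ* W.Ω) = 0 := by
    have := congrArg (fun x => x ᵥ* W.P 0) hc
    simp only [Matrix.add_vecMul, Matrix.smul_vecMul, Matrix.zero_vecMul, hPΩ, hP0, hP1,
      smul_zero, add_zero] at this
    exact this
  obtain ⟨hc0, hc1⟩ := row_eq_zero_of_smul_add_smul W hΩ hd h0 hA
  rw [hc0, hc1, zero_smul, zero_smul, zero_add, zero_add] at hc
  obtain ⟨hc2, hc3⟩ := row_eq_zero_of_smul_add_smul W hΩ hd h1 hc
  funext i
  fin_cases i <;> assumption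

/-- `c ᵥ* (rows w, wΩ, w₁, w₁Ω)` is the linear combination with coordinates `c` -/
theorem vecMul_rowMat (w w₁ : Fin 4 → k) (c : Fin 4 → k) :
    c ᵥ* (Matrix.of fun i j => (![w, w ᵥ* W.Ω, w₁, w₁ ᵥ* W.Ω] i) j) =
      c 0 • w + c 1 • (w ᵥ* W.Ω) + c 2 • w₁ + c 3 • (w₁ ᵥ* W.Ω) := by
  funext j
  change ∑ i, c i * (Matrix.of fun i j => (![w, w ᵥ* W.Ω, w₁, w₁ ᵥ* W.Ω] i) j) i j = _
  simp only [Matrix.of_apply, Fin.sum_univ_four, Pi.add_apply, Pi.smul_apply, smul_eq_mul,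
    Matrix.cons_val_zero, Matrix.cons_val_one, Matrix.cons_val_two, Matrix.cons_val_three,
    Matrix.head_cons, Matrix.tail_cons]

/-- the row basis matrix `(w; wΩ; w₁; w₁Ω)` is invertible over `k` -/
theorem det_rowMat_ne_zero {d : k} (hΩ : W.Ω * W.Ω = -(d • (1 : Matrix (Fin 4) (Fin 4) k)))
    (hd : ¬ IsSquare (-d)) {w w₁ : Fin 4 → k} (h0 : w ≠ 0) (h1 : w₁ ≠ 0)
    (hP0 : w ᵥ* W.P 0 = w) (hP1 : w₁ ᵥ* W.P 0 = 0) :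
    (Matrix.of fun i j => (![w, w ᵥ* W.Ω, w₁, w₁ ᵥ* W.Ω] i) j).det ≠ 0 := by
  intro hdet
  obtain ⟨c, hc, hEc⟩ := Matrix.exists_vecMul_eq_zero_iff.2 hdet
  apply hc
  rw [vecMul_rowMat W] at hEc
  exact row_coords_eq_zero W hΩ hd h0 h1 hP0 hP1 c hEc

/-- a non-zero matrix moves some row vector -/
theorem exists_vecMul_ne_zero {Q : Matrix (Fin 4) (Fin 4) k} (hQ : Q ≠ 0) :
    ∃ v : Fin 4 → k, v ᵥ* Q ≠ 0 := by
  by_contra hcon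
  simp only [not_exists, not_not] at hcon
  apply hQ
  ext i j
  have := congrFun (hcon (Pi.single i 1)) j
  simpa [Matrix.single_vecMul] using this

/-- a matrix of rank `2` is not zero -/
theorem ne_zero_of_rank_two {Q : Matrix (Fin 4) (Fin 4) k} (hQ : Q.rank = 2) : Q ≠ 0 := by
  intro h
  rw [h, Matrix.rank_zero] at hQ
  exact absurd hQ (by norm_num)

/-- `P₀ P₁ = 0` -/
theorem P0_mul_P1 : W.P 0 * W.P 1 = 0 := by
  have h := congrArg (fun M => W.P 0 * M) W.P_sum
  simp only [mul_add, W.P_idem 0, mul_one] at h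
  exact (add_eq_left).1 h

/-- `P₁ P₀ = 0` -/
theorem P1_mul_P0 : W.P 1 * W.P 0 = 0 := by
  have h := congrArg (fun M => M * W.P 0) W.P_sum
  simp only [add_mul, W.P_idem 0, one_mul] at h
  exact (add_eq_left).1 h

/-! ### the trace form `β(u, v) = u ᵥ* B ⬝ᵥ v` -/

/-- `β(uΩ, v) = −β(u, vΩ)` from `Ω B = −B Ωᵀ` -/
theorem form_vecMul_Omega_left (hΩB : W.Ω * W.B = -(W.B * W.Ω.transpose)) (u v : Fin 4 → k) :
    (u ᵥ* W.Ω) ᵥ* W.B ⬝ᵥ v = -((u ᵥ* W.B) ⬝ᵥ (v ᵥ* W.Ω)) := by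
  rw [Matrix.vecMul_vecMul, hΩB, Matrix.vecMul_neg, neg_dotProduct, ← Matrix.vecMul_vecMul,
    ← Matrix.dotProduct_mulVec, Matrix.mulVec_transpose]

/-- `β(uΩ, uΩ) = d β(u, u)` -/
theorem form_vecMul_Omega_self {d : k} (hΩ : W.Ω * W.Ω = -(d • (1 : Matrix (Fin 4) (Fin 4) k)))
    (hΩB : W.Ω * W.B = -(W.B * W.Ω.transpose)) (u : Fin 4 → k) :
    (u ᵥ* W.Ω) ᵥ* W.B ⬝ᵥ (u ᵥ* W.Ω) = d * (u ᵥ* W.B ⬝ᵥ u) := by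
  rw [form_vecMul_Omega_left W hΩB, vecMul_vecMul_Omega W hΩ, dotProduct_neg, dotProduct_smul,
    neg_neg, smul_eq_mul]

end RowRational

/-! ### definiteness: `β(w, w) ≠ 0` for `w ≠ 0` -/

section Definite

variable {k : Type} [Field k] (W : PlaneData k)

/-- under a real embedding at which `B` is (positive or negative) definite, `β(w, w) ≠ 0` for `w ≠ 0` -/
theorem form_self_ne_zero (hW : ∃ σ : k →+* ℝ, (W.B.map σ).PosDef ∨ (-(W.B.map σ)).PosDef)
    {w : Fin 4 → k} (hw : w ≠ 0) : w ᵥ* W.B ⬝ᵥ w ≠ 0 := by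
  obtain ⟨σ, hσ⟩ := hW
  have hwσ : σ ∘ w ≠ 0 := by
    intro h
    apply hw
    funext i
    have := congrFun h i
    simp only [Function.comp_apply, Pi.zero_apply] at this
    exact σ.injective (by rw [this, Pi.zero_apply, map_zero])
  have hval : σ (w ᵥ* W.B ⬝ᵥ w) = star (σ ∘ w) ⬝ᵥ ((W.B.map σ) *ᵥ (σ ∘ w)) := by
    rw [star_trivial, Matrix.dotProduct_mulVec, RingHom.map_dotProduct]
    congr 1
    funext i
    exact RingHom.map_vecMul σ W.B w i
  intro h0
  rw [h0, map_zero] at hval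
  rcases hσ with hpos | hneg
  · have := hpos.dotProduct_mulVec_pos hwσ
    rw [← hval] at this
    exact lt_irrefl _ this
  · have := hneg.dotProduct_mulVec_pos hwσ
    rw [Matrix.neg_mulVec, dotProduct_neg, ← hval, neg_zero] at this
    exact lt_irrefl _ this

end Definite

/-! ## Part B — the adelic side -/

section RowAdelic

variable {k : Type} [Field k] [NumberField k] (W : PlaneData k)

/-- a rational matrix on a rational row vector, adelically -/
theorem vecMul_adMat_algebraMap_comp (v : Fin 4 → k) (A : Matrix (Fin 4) (Fin 4) k) :
    (algebraMap k (Ad k) ∘ v) ᵥ* adMat k A = algebraMap k (Ad k) ∘ (v ᵥ* A) := by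
  funext i
  exact (RingHom.map_vecMul (algebraMap k (Ad k)) A v i).symm

/-- the adelic form of rational row vectors is the image of the rational form -/
theorem form_algebraMap_comp (u v : Fin 4 → k) :
    (algebraMap k (Ad k) ∘ u) ᵥ* adMat k W.B ⬝ᵥ (algebraMap k (Ad k) ∘ v) =
      algebraMap k (Ad k) (u ᵥ* W.B ⬝ᵥ v) := by
  rw [vecMul_adMat_algebraMap_comp, RingHom.map_dotProduct]

/-- a rational matrix with non-zero determinant is an adelic unit -/
theorem isUnit_adMat_of_det_ne_zero' {E : Matrix (Fin 4) (Fin 4) k} (h : E.det ≠ 0) :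
    IsUnit (adMat k E) := by
  rw [Matrix.isUnit_iff_isUnit_det]
  have : (adMat k E).det = algebraMap k (Ad k) E.det := by
    rw [RingHom.map_det, RingHom.mapMatrix_apply]
    rfl
  rw [this]
  exact (isUnit_iff_ne_zero.2 h).map (algebraMap k (Ad k))

/-- adelic row coordinates exist -/
theorem exists_vecMul_eq {E : Matrix (Fin 4) (Fin 4) k} (h : E.det ≠ 0) (y : Fin 4 → Ad k) :
    ∃ c : Fin 4 → Ad k, c ᵥ* adMat k E = y := by
  refine ⟨y ᵥ* (adMat k E)⁻¹, ?_⟩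
  rw [Matrix.vecMul_vecMul, Matrix.nonsing_inv_mul _
    ((Matrix.isUnit_iff_isUnit_det _).1 (isUnit_adMat_of_det_ne_zero' h)), Matrix.vecMul_one]

/-- adelic row coordinates are unique -/
theorem vecMul_injective_of_det_ne_zero {E : Matrix (Fin 4) (Fin 4) k} (h : E.det ≠ 0)
    {c c' : Fin 4 → Ad k} (hcc : c ᵥ* adMat k E = c' ᵥ* adMat k E) : c = c' := by
  have hu := (Matrix.isUnit_iff_isUnit_det _).1 (isUnit_adMat_of_det_ne_zero' h)
  have := congrArg (fun x => x ᵥ* (adMat k E)⁻¹) hcc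
  simpa [Matrix.vecMul_vecMul, Matrix.mul_nonsing_inv _ hu, Matrix.vecMul_one] using this

/-- the adelic row basis matrix: `c ᵥ* adMat (w; wΩ; w₁; w₁Ω)` -/
theorem vecMul_adMat_rowMat (w w₁ : Fin 4 → k) (c : Fin 4 → Ad k) :
    c ᵥ* adMat k (Matrix.of fun i j => (![w, w ᵥ* W.Ω, w₁, w₁ ᵥ* W.Ω] i) j) =
      c 0 • (algebraMap k (Ad k) ∘ w) + c 1 • (algebraMap k (Ad k) ∘ (w ᵥ* W.Ω)) +
        c 2 • (algebraMap k (Ad k) ∘ w₁) + c 3 • (algebraMap k (Ad k) ∘ (w₁ ᵥ* W.Ω)) := by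
  funext j
  change ∑ i, c i * (adMat k (Matrix.of fun i j => (![w, w ᵥ* W.Ω, w₁, w₁ ᵥ* W.Ω] i) j)) i j = _
  simp only [adMat, Matrix.map_apply, Matrix.of_apply, Fin.sum_univ_four, Pi.add_apply, Pi.smul_apply,
    smul_eq_mul, Function.comp_apply, Matrix.cons_val_zero, Matrix.cons_val_one, Matrix.cons_val_two,
    Matrix.cons_val_three, Matrix.head_cons, Matrix.tail_cons]

end RowAdelic

end Summit.Ventures.HodgeRepro.Tier4.Line1

end
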